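import Summits.QuantumFields.YangMills.Theorems.ColdStartUniversalityShenZhuZhuWilsonLoopImSUN
import HarnessLib

/-!
# LARGE-`N` FACTORISATION OF WILSON LOOPS at strong coupling, UNCONDITIONALLY, in every dimension: Shen–Zhu–Zhu's Corollary 1.5 for `SU(N)` —
# `μ_N{|W_ℓ/N − 𝐄W_ℓ/N| ≥ ε} → 0` and `𝐄(W_{ℓ₁}⋯W_{ℓ_m}/N^m) − Π_i 𝐄(W_{ℓ_i}/N) → 0` as `N → ∞`, for `|β| < 1/(8d)` ('t Hooft scaling)

Seat `ym-line-csu-p1` (g39), route `ColdStartUniversality` of `Summits/QuantumFields/YangMills`, helper file G26 (strong coupling;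
`--supports stmt-QuantumFields-24809`).  The Literature (`ShenZhuZhuPoincareApplications`) proves SZZ's large-`N` consequences (1.13) and the
factorisation of Wilson loops FROM the named fact `shenZhuZhu_largeN_variance d N` for all `N` (`shenZhuZhu_largeN_inProbability_SU`,
`shenZhuZhu_largeN_factorisation_SU`, hypothesis `h : ∀ N, shenZhuZhu_largeN_variance d N`), whose `SO(N)` halves are not in reach.  For the `SU(N)`
family the hypothesis is unnecessary: G25's kernel theorem `szzLoopVarianceBound_sun` (`SZZLoopVarianceBound (fundamentalRep (Fin N)) d (Nβ) (8/K_N)`,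
`K_N = N(1/2 − 4d|β|)`, from the venture `YMGap`'s multi-link Bakry–Émery inequality) feeds the Literature's Chebyshev / induction lemmas
(`SZZLoopVarianceBound.measureReal_deviation_le`, `.norm_integral_prod_sub_le`) directly, and `8/K_N · n(n−3)/N ≤ (8/(1/2 − 4d|β|))·n(n−3)/N → 0`.

* `sharpWindow_const_pos`, bookkeeping limits.
* ★★★ `shenZhuZhu_largeN_inProbability_SU_sharp` — for `d ≥ 1`, `|β| < 1/(8d)`, ANY choice of infinite-volume limit points `μ_N` (eventually in `N`),
  every loop `ℓ` and `ε > 0`: `μ_N{|W_ℓ/N − 𝐄_{μ_N}W_ℓ/N| ≥ ε} → 0` (SZZ (1.13)), NO named-fact hypothesis.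
* ★★★ `shenZhuZhu_largeN_factorisation_SU_sharp` — `𝐄_{μ_N}(Π_i W_{ℓ_i}/N) − Π_i 𝐄_{μ_N}(W_{ℓ_i}/N) → 0` (SZZ Cor. 1.5, factorisation), NO named-fact hypothesis.
* ★★★ `shenZhuZhu_largeN_inProbability_SU_unconditional`, `shenZhuZhu_largeN_factorisation_SU_unconditional` — the Literature statements verbatim
  (`2 ≤ d`, `|β| < szzThresholdSU d = 1/(16(d−1)) ≤ 1/(8d)`) with the hypothesis `h` removed.

THEOREMS ONLY, no definition, no sorry.  HONEST FRAMING: STRONG coupling, lattice, `SU(N)` only (the `SO(N)` statements of the Literature stay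
conditional); nothing at weak coupling / in the continuum, nothing `K`-uniform along the route's scaling (`UniformColdStartMixing`, 24809, ASIDE, not
restated); no crux, rung or summit statement is proved; the Yang–Mills mass gap is NOT proved.

References: H. Shen, R. Zhu, X. Zhu, CMP 400 (2023) 805–851 = arXiv:2204.12737, Cor. 1.5 ((1.12), (1.13), factorisation), §4.2 [ShenZhuZhu2022].
-/

set_option autoImplicit false

noncomputable section

namespace Summit.QuantumFields.YangMills.Theorems.ColdStartUniversality

open MeasureTheory ProbabilityTheory Finset Filter Set Function
open scoped BigOperators NNReal ENNReal Topology Matrix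
open SimpleGraph
open Literature.Probability.LatticeModels (zdGraph)
open Literature.MathematicalPhysics.QuantumFieldTheory
open Literature.MathematicalPhysics.QuantumLattice (fundamentalRep continuous_fundamentalRep fundamentalRep_apply fundamentalRep_mem_unitaryGroup
  LGConfig infiniteVolumeLimitPoints)
open Literature.MathematicalPhysics.QuantumFieldTheory.SUNBakryEmery (SUN)

variable {d : ℕ}

/-! ## §1. Bookkeeping: the sharp constant `K_N = N(1/2 − 4d|β|)` -/

/-- For `d ≥ 1` and `|β| < 1/(8d)`: `1/2 − 4d|β| > 0`. [folklore] -/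
theorem sharpWindow_const_pos (hd : 1 ≤ d) {β : ℝ} (hβ : |β| < 1 / (8 * d)) : 0 < 1 / 2 - 4 * (d : ℝ) * |β| := by
  have hd' : (1 : ℝ) ≤ d := by exact_mod_cast hd
  have h8 : (0 : ℝ) < 8 * d := by positivity
  have h := (lt_div_iff₀ h8).1 hβ
  nlinarith

/-- `K_N = N/2 − 4dN|β| = N·(1/2 − 4d|β|)`, so `K_N ≥ 1/2 − 4d|β| > 0` and `8/K_N ≤ 8/(1/2 − 4d|β|)` for `N ≥ 1`. [folklore] -/
theorem sharpWindow_const_le (hd : 1 ≤ d) {β : ℝ} (hβ : |β| < 1 / (8 * d)) {N : ℕ} (hN : 1 ≤ N) :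
    0 < (N : ℝ) / 2 - N * |β| * (4 * d) ∧ 8 / ((N : ℝ) / 2 - N * |β| * (4 * d)) ≤ 8 / (1 / 2 - 4 * (d : ℝ) * |β|) := by
  have hc := sharpWindow_const_pos hd hβ
  have hN' : (1 : ℝ) ≤ N := by exact_mod_cast hN
  have hK : 1 / 2 - 4 * (d : ℝ) * |β| ≤ (N : ℝ) / 2 - N * |β| * (4 * d) := by
    have : (N : ℝ) / 2 - N * |β| * (4 * d) = N * (1 / 2 - 4 * (d : ℝ) * |β|) := by ring
    rw [this]; nlinarith
  exact ⟨lt_of_lt_of_le hc hK, div_le_div_of_nonneg_left (by norm_num) hc hK⟩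

/-! ## §2. Large-`N` limits, unconditionally -/

/-- ★★★ **SZZ Corollary 1.5, (1.13), for `SU(N)`, UNCONDITIONALLY, every `d ≥ 1`, `|β| < 1/(8d)`**: for ANY choice of infinite-volume limit points
`μ_N ∈ infiniteVolumeLimitPoints (fundamentalRep (Fin N)) (Nβ)` (eventually in `N`), every loop `ℓ` and every `ε > 0`:
`μ_N{|W_ℓ/N − 𝐄W_ℓ/N| ≥ ε} → 0` as `N → ∞` (indeed `≤ 8n(n−3)/((1/2 − 4d|β|) N ε²)`).  No named-fact hypothesis.  The Yang–Mills mass gap is NOT proved.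
[cite: ShenZhuZhu2022, Corollary 1.5 (1.13)] -/
theorem shenZhuZhu_largeN_inProbability_SU_sharp (hd : 1 ≤ d) {β : ℝ} (hβ : |β| < 1 / (8 * d))
    (μ : (N : ℕ) → Measure (LGConfig d (Matrix.specialUnitaryGroup (Fin N) ℂ)))
    (hμ : ∀ᶠ N in atTop, μ N ∈ infiniteVolumeLimitPoints (d := d) (fundamentalRep (Fin N)) ((N : ℝ) * β))
    {x : Literature.Probability.LatticeModels.Site d} {w : (zdGraph d).Walk x x} (hw : IsNonBacktrackingLoop w) {ε : ℝ} (hε : 0 < ε) :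
    Tendsto (fun N : ℕ => (μ N).real {U | ε ≤ ‖wilsonLoopTrace (fundamentalRep (Fin N)) w U / N -
        ∫ V, wilsonLoopTrace (fundamentalRep (Fin N)) w V / N ∂(μ N)‖}) atTop (𝓝 0) := by
  have hc := sharpWindow_const_pos hd hβ
  set a : ℝ := (w.length : ℝ) * ((w.length : ℝ) - 3) with ha
  have h4 : (4 : ℝ) ≤ w.length := by exact_mod_cast four_le_length_of_isNonBacktrackingLoop hw
  have ha0 : 0 ≤ a := by rw [ha]; nlinarith
  have hg : Tendsto (fun N : ℕ => 8 / (1 / 2 - 4 * (d : ℝ) * |β|) * a / ε ^ 2 / (N : ℝ)) atTop (𝓝 0) :=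
    tendsto_const_div_atTop_nhds_zero_nat _
  refine squeeze_zero' (Eventually.of_forall fun N => measureReal_nonneg) ?_ hg
  filter_upwards [hμ, eventually_ge_atTop 1] with N hμN hN
  haveI : SecondCountableTopology (Matrix (Fin N) (Fin N) ℂ) := inferInstanceAs (SecondCountableTopology (Fin N → Fin N → ℂ))
  haveI : SecondCountableTopology (Matrix.specialUnitaryGroup (Fin N) ℂ) := Topology.IsEmbedding.subtypeVal.secondCountableTopology
  obtain ⟨hK, h8⟩ := sharpWindow_const_le hd hβ hN
  have hN0 : N ≠ 0 := by omega
  have hNpos : (0 : ℝ) < N := by exact_mod_cast hN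
  have hdev := (szzLoopVarianceBound_sun (d := d) hN0 hK le_rfl).measureReal_deviation_le (continuous_fundamentalRep (Fin N))
    fundamentalRep_mem_unitaryGroup hμN hw hε
  refine hdev.trans ?_
  rw [← ha]
  have e : 8 / (1 / 2 - 4 * (d : ℝ) * |β|) * a / ε ^ 2 / (N : ℝ) = 8 / (1 / 2 - 4 * (d : ℝ) * |β|) * (a / N) / ε ^ 2 := by
    field_simp
  rw [e]
  exact div_le_div_of_nonneg_right (mul_le_mul_of_nonneg_right h8 (div_nonneg ha0 hNpos.le)) (sq_nonneg ε)

/-- ★★★ **SZZ Corollary 1.5, factorisation of Wilson loops, for `SU(N)`, UNCONDITIONALLY, every `d ≥ 1`, `|β| < 1/(8d)`**: for any choice of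
infinite-volume limit points `μ_N` (eventually in `N`) and loops `ℓ₁, …, ℓ_m`: `𝐄_{μ_N}(W_{ℓ₁}⋯W_{ℓ_m}/N^m) − Π_i 𝐄_{μ_N}(W_{ℓ_i}/N) → 0` as `N → ∞`.
No named-fact hypothesis.  The Yang–Mills mass gap is NOT proved. [cite: ShenZhuZhu2022, Corollary 1.5 (factorization)] -/
theorem shenZhuZhu_largeN_factorisation_SU_sharp (hd : 1 ≤ d) {β : ℝ} (hβ : |β| < 1 / (8 * d))
    (μ : (N : ℕ) → Measure (LGConfig d (Matrix.specialUnitaryGroup (Fin N) ℂ)))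
    (hμ : ∀ᶠ N in atTop, μ N ∈ infiniteVolumeLimitPoints (d := d) (fundamentalRep (Fin N)) ((N : ℝ) * β))
    (ls : List (Σ x : Literature.Probability.LatticeModels.Site d, (zdGraph d).Walk x x)) (hls : ∀ l ∈ ls, IsNonBacktrackingLoop l.2) :
    Tendsto (fun N : ℕ =>
        ∫ U, (ls.map fun l => wilsonLoopTrace (fundamentalRep (Fin N)) l.2 U / N).prod ∂(μ N) -
          (ls.map fun l => ∫ U, wilsonLoopTrace (fundamentalRep (Fin N)) l.2 U / N ∂(μ N)).prod)
      atTop (𝓝 0) := by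
  have hc := sharpWindow_const_pos hd hβ
  set c : ℝ := 8 / (1 / 2 - 4 * (d : ℝ) * |β|) with hcdef
  rw [tendsto_zero_iff_norm_tendsto_zero]
  have hg : Tendsto (fun N : ℕ => (ls.map fun l => Real.sqrt (c * ((l.2.length : ℝ) * ((l.2.length : ℝ) - 3)) / (N : ℝ))).sum)
      atTop (𝓝 0) := by
    have key := tendsto_list_sum (a := fun _ => (0 : ℝ)) ls (fun l _ =>
      show Tendsto (fun N : ℕ => Real.sqrt (c * ((l.2.length : ℝ) * ((l.2.length : ℝ) - 3)) / (N : ℝ))) atTop (𝓝 0) by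
        simpa only [Function.comp_def, Real.sqrt_zero] using (Real.continuous_sqrt.tendsto 0).comp
          (tendsto_const_div_atTop_nhds_zero_nat (c * ((l.2.length : ℝ) * ((l.2.length : ℝ) - 3)))))
    simpa using key
  refine squeeze_zero' (Eventually.of_forall fun N => norm_nonneg _) ?_ hg
  filter_upwards [hμ, eventually_ge_atTop 1] with N hμN hN
  haveI : SecondCountableTopology (Matrix (Fin N) (Fin N) ℂ) := inferInstanceAs (SecondCountableTopology (Fin N → Fin N → ℂ))
  haveI : SecondCountableTopology (Matrix.specialUnitaryGroup (Fin N) ℂ) := Topology.IsEmbedding.subtypeVal.secondCountableTopology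
  obtain ⟨hK, h8⟩ := sharpWindow_const_le hd hβ hN
  have hN0 : N ≠ 0 := by omega
  have hNpos : (0 : ℝ) < N := by exact_mod_cast hN
  have hdev := (szzLoopVarianceBound_sun (d := d) hN0 hK le_rfl).norm_integral_prod_sub_le (continuous_fundamentalRep (Fin N))
    fundamentalRep_mem_unitaryGroup hμN ls hls
  refine hdev.trans (List.sum_le_sum fun l hl => Real.sqrt_le_sqrt ?_)
  have h4 : (4 : ℝ) ≤ l.2.length := by exact_mod_cast four_le_length_of_isNonBacktrackingLoop (hls l hl)
  have ha0 : 0 ≤ (l.2.length : ℝ) * ((l.2.length : ℝ) - 3) := by nlinarith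
  calc 8 / ((N : ℝ) / 2 - N * |β| * (4 * d)) * ((l.2.length : ℝ) * ((l.2.length : ℝ) - 3) / (N : ℝ))
      ≤ c * ((l.2.length : ℝ) * ((l.2.length : ℝ) - 3) / (N : ℝ)) := mul_le_mul_of_nonneg_right h8 (div_nonneg ha0 hNpos.le)
    _ = c * ((l.2.length : ℝ) * ((l.2.length : ℝ) - 3)) / (N : ℝ) := (mul_div_assoc _ _ _).symm

/-! ## §3. The Literature statements with the named-fact hypothesis removed -/

/-- SZZ's window is inside the sharp one: `|β| < 1/(16(d−1)) ≤ 1/(8d)` for `d ≥ 2`. [cite: ShenZhuZhu2022, (1.3)] -/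
theorem abs_lt_sharp_of_lt_szzThresholdSU (hd : 2 ≤ d) {β : ℝ} (hβ : |β| < szzThresholdSU d) : |β| < 1 / (8 * d) := by
  have hd' : (2 : ℝ) ≤ d := by exact_mod_cast hd
  refine hβ.trans_le ?_
  simp only [szzThresholdSU]
  rw [one_div_le_one_div (by nlinarith) (by positivity)]
  nlinarith

/-- ★★★ **`shenZhuZhu_largeN_inProbability_SU` WITHOUT the named-fact hypothesis**: SZZ Cor. 1.5 (1.13) for `SU(N)` under SZZ's printed window
`|β| < 1/(16(d−1))`, `d ≥ 2`.  The Yang–Mills mass gap is NOT proved. [cite: ShenZhuZhu2022, Corollary 1.5 (1.13)] -/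
theorem shenZhuZhu_largeN_inProbability_SU_unconditional (hd : 2 ≤ d) {β : ℝ} (hβ : |β| < szzThresholdSU d)
    (μ : (N : ℕ) → Measure (LGConfig d (Matrix.specialUnitaryGroup (Fin N) ℂ)))
    (hμ : ∀ᶠ N in atTop, μ N ∈ infiniteVolumeLimitPoints (d := d) (fundamentalRep (Fin N)) ((N : ℝ) * β))
    {x : Literature.Probability.LatticeModels.Site d} {w : (zdGraph d).Walk x x} (hw : IsNonBacktrackingLoop w) {ε : ℝ} (hε : 0 < ε) :
    Tendsto (fun N : ℕ => (μ N).real {U | ε ≤ ‖wilsonLoopTrace (fundamentalRep (Fin N)) w U / N -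
        ∫ V, wilsonLoopTrace (fundamentalRep (Fin N)) w V / N ∂(μ N)‖}) atTop (𝓝 0) :=
  shenZhuZhu_largeN_inProbability_SU_sharp (le_trans one_le_two hd) (abs_lt_sharp_of_lt_szzThresholdSU hd hβ) μ hμ hw hε

/-- ★★★ **`shenZhuZhu_largeN_factorisation_SU` WITHOUT the named-fact hypothesis**: SZZ Cor. 1.5 (factorisation of Wilson loops in the large-`N`
limit) for `SU(N)` under SZZ's printed window `|β| < 1/(16(d−1))`, `d ≥ 2`.  The Yang–Mills mass gap is NOT proved.
[cite: ShenZhuZhu2022, Corollary 1.5 (factorization)] -/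
theorem shenZhuZhu_largeN_factorisation_SU_unconditional (hd : 2 ≤ d) {β : ℝ} (hβ : |β| < szzThresholdSU d)
    (μ : (N : ℕ) → Measure (LGConfig d (Matrix.specialUnitaryGroup (Fin N) ℂ)))
    (hμ : ∀ᶠ N in atTop, μ N ∈ infiniteVolumeLimitPoints (d := d) (fundamentalRep (Fin N)) ((N : ℝ) * β))
    (ls : List (Σ x : Literature.Probability.LatticeModels.Site d, (zdGraph d).Walk x x)) (hls : ∀ l ∈ ls, IsNonBacktrackingLoop l.2) :
    Tendsto (fun N : ℕ =>
        ∫ U, (ls.map fun l => wilsonLoopTrace (fundamentalRep (Fin N)) l.2 U / N).prod ∂(μ N) -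
          (ls.map fun l => ∫ U, wilsonLoopTrace (fundamentalRep (Fin N)) l.2 U / N ∂(μ N)).prod)
      atTop (𝓝 0) :=
  shenZhuZhu_largeN_factorisation_SU_sharp (le_trans one_le_two hd) (abs_lt_sharp_of_lt_szzThresholdSU hd hβ) μ hμ ls hls

end Summit.QuantumFields.YangMills.Theorems.ColdStartUniversality

end
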